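import Summits.ABC.IUTFork.Cor312SlotLicenceTame
import Summits.ABC.IUTFork.Cor312LicenceTameBoundaryRealising
import HarnessLib

/-!
# [IUTchIII] Cor. 3.12 at the sharp real settings — the SLOT licence (reading (P)) at BALL fibres (strata U1 ∪ U1½: tame `e ≤ p − 2`,
# and the boundary `e = p − 1` with `ζ_p ∉ K_x`): the ball mover chain of abc-iut-D1-prv (p454898 / p456193 / p456372) lives in (Ind2),
# hence proves `Cor312.Setting.SlotLicence`; at uniformly-indexed torsion-free sub-wild realising data the SLOT licence IS the T1½ predicate

PROOF-ONLY record file (D-0012; 0 definitions, 0 `Prop` facts, no instance) of the abc-iut cell (prover abc-iut-D1-prv, gen 5; D-0079 R-C/R-W,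
row «γ:SLOT-BALL» = residual (i) of this seat's RQ7 read of abc-iut-C-cert-2's γ-line non-vacuity file `Cor312SlotLicenceMovers.lean` p460145,
STATUS 2026-08-26T18:58Z; sequel of abc-iut-C-cert-2's `Cor312SlotLicenceTame.lean` p462118 / `Cor312SlotLicenceTameIff.lean` p462292, which do
the uniformly TAME regime). TAKES NO SIDE on [IUTchIII] Cor. 3.12 (S. Mochizuki, *Inter-universal Teichmüller theory III*, kurims manuscript,
Cor. 3.12 p. 173–174, Step (xi-f) p. 184 l. 19–29; Thm. 3.11 (i) (Ind2) p. 154) or on any author (Mochizuki / Scholze–Stix / Joshi / Dupuy–Hilado):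
statements about OUR typed sharp containers (abc-iut-c312-3 / c312-7 `settingDHVolSharp` / `settingPrVolSharp`) and Dupuy–Hilado's typed (Ind2);
the slot licence is a STRONGER-THAN-PRINT reading of Step (xi-f) (print: a log-VOLUME in a subset of ℝ, hull of the union of ALL possible
images); nothing here bears on the printed GLOBAL inequality. typed ≠ proved; instantiated ≠ endorsed.

THE POINT. abc-iut-C-cert-2's γ certificate `Conditional.abc_of_slotLicence_orNumP_K_szpiroBad` (p458998) consumes its number-level binder only
where OUR SLOT licence FAILS; its non-vacuity files p460145 (one-factor movers) and p462118/p462292 (uniformly tame multi-slot movers) show the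
slot licence HOLDS wherever those (U)-licence engines bite. The ball engines of abc-iut-D1-prv — `exists_mem_ismDH_norm_one_ge_of_ball` /
`exists_mem_ismDH_norm_labelIdele_ge_of_ball` (`Cor312LicenceBallFibreMovers`, p454898), assembled by abc-iut-w5-d180's multi-slot targets — are
likewise ONE-PLACE (Ind2) elements on every capsule slot, with NO capsule permutation; so the same proofs, run through abc-iut-C-cert-2's slot
targets engine `qRegion_subset_thetaSlotHull_settingDHVolSharp_of_targets` (p462118), give the SLOT licence on the ball strata:
* `qRegion_subset_thetaSlotHull_settingDHVolSharp_of_ball_slots` / `_of_ball_orders` — packet level, twins of p454898;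
* `slotLicence_settingDHVolSharp_of_ball_orders` / `slotLicence_settingPrVolSharp_of_ball_orders` — licence level, twins of abc-iut-D1-prv's
  `licence_settingDHVolSharp_of_ball_orders` (`Cor312LicenceTameBoundary`, p456193);
* **`slotLicence_settingPrVolSharp_iff_of_realises_boundary`** — for Θ- and q-ideles REALISING the pilot divisors with integral q-degrees `P_w ≥ 1`,
  every place `x` over a bad prime `p` having `p > 2`, ONE index `e_p = e(x|p) ≤ p − 1` and no non-trivial `p`-th root of unity in `K_x`
  (abc-iut-w6-d060 `TorsionFree.logUnits_eq_closedBall_of_le_pred`: the unit-log shell is the ball `𝔪_x`):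
  `SlotLicence ⟺ ∀ bad w | p, ∀ j = i+1: e_p·((j²·P_w − 1) div e_p) + 1 − j·(e_p − 1) ≤ P_w` — the SAME integer predicate as abc-iut-D1-prv's
  (U)-licence theorem `licence_settingPrVolSharp_iff_of_realises_boundary` (p456372); (⟹) through `Cor312.Setting.licence_of_slotLicence` and p456372,
  (⟸) through the slot ball-orders chain. Hence on the whole stratum U1 ∪ U1½ (uniform index per bad prime) the (U)-licence and the SLOT licence
  are EQUIVALENT and decided by ONE predicate: every WINDOW-TABLE U1½ verdict (col «T1½») is a verdict for the γ line's S-side clause too.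
NOT COVERED (honest scope): non-uniform indices inside a fibre — abc-iut-w4-d006's BALL-PAIRS criterion (p458601) uses an (Ind1) capsule permutation
in its companion-slot case and is NOT a slot statement; wild places (`e ≥ p`, or `e = p − 1` with `ζ_p ∈ K_x`; stratum U2).
[cite: Mochizuki2012, IUTchIII Thm. 3.11 (i) p. 154, Cor. 3.12 Step (xi-f) p. 184; IUTchIV Prop. 1.1 p. 9, Prop. 1.2 (i)(ii) p. 10]
[cite: DupuyHilado2025, §3.3, §3.4, §3.9, §4.9, §4.11–4.12] [cite: NeukirchANT1999, Ch. II Prop. (5.5)–(5.7), (6.8)] [cite: WeilBNT1967, Ch. II §2, Th. 1]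
[claim: Mochizuki2012, status: disputed] for every IUT sentence quoted.
-/

noncomputable section

open Set Metric Function
open scoped Pointwise

namespace Summit.ABC.IUTFork.Thm311.Real

open Cor312 Cor312.Setting Cor312Vol Cor312Vol.ExplicitDepth Literature.IUT.LogThetaLattice Literature.IUT.LogVolume NumberField
  IsDedekindDomain
open Literature.NumberTheory.NumberFields Literature.NumberTheory.GaloisRepresentations.Ultrametric

variable {F : Type} [Field F] [NumberField F] (X : PilotData F) {logv : PadicLogs F} (hlog : LogvAnalytic logv)
  (M : Type) [Field M] [NumberField M]
  (archPk : ∀ (j : (thetaIndex X).Label) (vQ : (thetaIndex X).VQ), Set ((logShellsDH X logv).Packet j vQ))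
  (archSub : ∀ (j : (thetaIndex X).Label) (v : (thetaIndex X).V),
    Set ((logShellsDH X logv).Packet j ((thetaIndex X).over v)))
  (Ψ : ℤ → ∀ v : (thetaIndex X).V, v ∈ (thetaIndex X).Vbad → Set ((logShellsDH X logv).StarPacket v))
  (act : ℤ → ∀ v : (thetaIndex X).V, v ∈ (thetaIndex X).Vbad →
    (logShellsDH X logv).StarPacket v → Module.End ℚ ((logShellsDH X logv).StarPacket v))
  (Mmod : ℤ → ∀ j : (thetaIndex X).LabelStar, Set ((logShellsDH X logv).GlobalPacket j.1))
  (region : ℤ → ∀ j : (thetaIndex X).LabelStar, FinDivisor M → ∀ vQ : (thetaIndex X).VQ,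
    Set ((logShellsDH X logv).Packet j.1 vQ))
  (n : ℤ) {HT : Type} {LogLink : HT → HT → Type} {IsFull : ∀ {s t : HT}, LogLink s t → Prop}
  (lat : LGPGaussianLogThetaLattice LogLink IsFull)
  {Frd : Type} {IsoF : Frd → Frd → Type} {Ob : Frd → Type} {realify : Frd → Frd} {Strip : Type}
  {IsoS : Strip → Strip → Type} {Mv : ∀ v : (thetaIndex X).V, v ∈ (thetaIndex X).Vbad → Type}
  [∀ v h, Monoid (Mv v h)]
  (sig : GlobalLGPFrobenioidSignature (thetaIndex X).lstar (thetaIndex X).V (· ∈ (thetaIndex X).Vbad)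
    Frd IsoF Ob realify Strip IsoS Mv)
  (split : SplittingMonoids Mv) {ObΔ : Type} {N : ∀ v : (thetaIndex X).V, v ∈ (thetaIndex X).Vbad → Type}
  [∀ v h, Monoid (N v h)] (qData : QPilotData ObΔ N)
  (tq : ∀ (pp : Nat.Primes) (x : (thetaIndex X).Fibre (.inr pp)), haveI : Fact (pp : ℕ).Prime := ⟨pp.2⟩; kOf X pp.1 x)
  (t : ∀ (pp : Nat.Primes) (_ : Fin X.lstar) (x : (thetaIndex X).Fibre (.inr pp)),
    haveI : Fact (pp : ℕ).Prime := ⟨pp.2⟩; kOf X pp.1 x)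
  (htq0 : ∀ pp x, tq pp x ≠ 0)
  (htq1 : ∀ (pp : Nat.Primes) (x : (thetaIndex X).Fibre (.inr pp)),
    haveI : Fact (pp : ℕ).Prime := ⟨pp.2⟩; placeOf X pp.1 x ∉ X.S → ‖tq pp x‖ = 1)

/-! ## 1. Packet level: the ball multi-slot chain inside (Ind2) -/

/-- **q-REGION ⊆ SLOT HULL AT `(i+1, p)` IN THE BALL MULTI-SLOT REGIME** — the reading-(P) twin of abc-iut-D1-prv's
`qRegion_subset_thetaHull_settingDHVolSharp_of_ball_slots` (p454898): the SAME data (a donation rate `ρ ≥ 1` with, at EVERY place `x | p`, a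
uniformizer `ϖ_x` with `log_p(𝒪_x^×) = {‖y‖ ≤ ‖ϖ_x‖}` and `ρ ≤ ‖p‖⁻¹·‖ϖ_x‖`; at every `w | p` EITHER `‖t_{q,w}‖ ≤ ‖t_{Θ,i+1,w}‖` OR
`t_{Θ,i+1,w}` on a `p`-level `k` of the ball with `‖t_{q,w}‖ ≤ ρ^{i+1}·‖p‖^k·‖ϖ‖`) put the q-pilot region at `(i+1, p)` inside the hull of the
union of the (Ind2)-SLOT images (`Cor312.Setting.thetaSlotHull`): the movers are ONE-PLACE (Ind2) elements on EVERY capsule slot (abc-iut-C-cert-2's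
slot targets engine `qRegion_subset_thetaSlotHull_settingDHVolSharp_of_targets`, p462118); no capsule permutation, no strip automorphism.
[cite: DupuyHilado2025, §3.9, §4.9, §4.11] [cite: WeilBNT1967, Ch. II §2, Th. 1] [claim: Mochizuki2012, status: disputed] -/
theorem qRegion_subset_thetaSlotHull_settingDHVolSharp_of_ball_slots (i : Fin (thetaIndex X).lstar) (pp : Nat.Primes) (ρ : ℝ)
    (hρ1 : 1 ≤ ρ)
    (hρ : haveI : Fact (pp : ℕ).Prime := ⟨pp.2⟩
      ∀ x : (thetaIndex X).Fibre (.inr pp),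
        ∃ ϖ : (kOf X pp.1 x)ˣ, IsUniformizer ϖ ∧
          logUnits (kOf X pp.1 x) = closedBall (0 : kOf X pp.1 x) ‖(ϖ : kOf X pp.1 x)‖ ∧
          ρ ≤ ‖(pp : ℚ_[pp])‖⁻¹ * ‖(ϖ : kOf X pp.1 x)‖)
    (hwin : haveI : Fact (pp : ℕ).Prime := ⟨pp.2⟩
      ∀ w : (thetaIndex X).Fibre (.inr pp),
        ‖tq pp w‖ ≤ ‖t pp i w‖ ∨
          ∃ (ϖ : (kOf X pp.1 w)ˣ) (k : ℤ),
            logUnits (kOf X pp.1 w) = closedBall (0 : kOf X pp.1 w) ‖(ϖ : kOf X pp.1 w)‖ ∧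
            ‖(pp : ℚ_[pp])‖ * (‖(pp : ℚ_[pp])‖ ^ k * ‖(ϖ : kOf X pp.1 w)‖) < ‖t pp i w‖ ∧
            ‖t pp i w‖ ≤ ‖(pp : ℚ_[pp])‖ ^ k * ‖(ϖ : kOf X pp.1 w)‖ ∧
            ‖tq pp w‖ ≤ ρ ^ ((i : ℕ) + 1) * (‖(pp : ℚ_[pp])‖ ^ k * ‖(ϖ : kOf X pp.1 w)‖)) :
    (settingDHVolSharp X hlog M archPk archSub Ψ act Mmod region n lat sig split qData tq t htq0 htq1).qRegion
        (labelSucc i) (.inr pp) ⊆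
      (settingDHVolSharp X hlog M archPk archSub Ψ act Mmod region n lat sig split qData tq t htq0 htq1).thetaSlotHull
        (labelSucc i) (.inr pp) := by
  haveI : Fact (pp : ℕ).Prime := ⟨pp.2⟩
  have hρ0 : 0 ≤ ρ := zero_le_one.trans hρ1
  -- per place: a last-slot target `N_w ≥ 0`, reached by a mover, with `‖t_{q,w}‖ ≤ ρ^{i+1}·N_w`
  have key : ∀ w : (thetaIndex X).Fibre (.inr pp), ∃ Nw : ℝ, 0 ≤ Nw ∧
      (∃ g ∈ ismDH logv w.1,
        Nw ≤ ‖(presAt X hlog pp).φ w (g (((presAt X hlog pp).φ w).symm (labelIdele X t pp (labelSucc i) w)))‖) ∧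
      ‖tq pp w‖ ≤ ρ ^ ((i : ℕ) + 1) * Nw := by
    intro w
    rcases hwin w with h | ⟨ϖ, k, hΛ, h1, h2, h3⟩
    · refine ⟨‖t pp i w‖, norm_nonneg _, ⟨LinearEquiv.refl ℚ _, refl_mem_ismDH logv w.1, ?_⟩, ?_⟩
      · rw [labelIdele_labelSucc]
        simp only [LinearEquiv.refl_apply, LinearEquiv.apply_symm_apply]
        exact le_of_eq rfl
      · exact h.trans (le_mul_of_one_le_left (norm_nonneg _) (one_le_pow₀ hρ1))
    · refine ⟨‖(pp : ℚ_[pp])‖ ^ k * ‖(ϖ : kOf X pp.1 w)‖,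
        mul_nonneg (zpow_nonneg (norm_nonneg _) _) (norm_nonneg _), ?_, h3⟩
      exact exists_mem_ismDH_norm_labelIdele_ge_of_ball X hlog t pp (labelSucc i) w k
        ⟨ϖ, hΛ, by rw [labelIdele_labelSucc]; exact h1, by rw [labelIdele_labelSucc]; exact h2, rfl⟩
  choose Nf hN0 hN hle using key
  refine qRegion_subset_thetaSlotHull_settingDHVolSharp_of_targets X hlog M archPk archSub Ψ act Mmod region n lat sig split qData
    tq t htq0 htq1 (labelSucc i) pp (fun _ => ρ) Nf (fun _ => hρ0) hN0 (fun x => ?_) hN fun e => ?_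
  · obtain ⟨ϖ, hϖ, hΛ, hρle⟩ := hρ x
    exact exists_mem_ismDH_norm_one_ge_of_ball X hlog pp x ⟨ϖ, hϖ, hΛ, hρle⟩
  · rw [Fin.prod_const]
    exact hle _

/-- **THE BALL MULTI-SLOT WINDOW IN ORDERS, SLOT READING** at the packet `(i+1, p)`, `j = i+1` — twin of abc-iut-D1-prv's
`qRegion_subset_thetaHull_settingDHVolSharp_of_ball_orders` (p454898) with `thetaHull ↦ thetaSlotHull`: every place `x` over `p` has the SAME
ramification index `e` and a uniformizer `ϖ_x` with `log_p(𝒪_x^×) = {‖y‖ ≤ ‖ϖ_x‖}`; at every `w | p` either `‖t_{q,w}‖ ≤ ‖t_{Θ,j,w}‖` or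
`‖t_{Θ,j,w}‖ = ‖ϖ_w‖^{m_Θ}`, `‖t_{q,w}‖ = ‖ϖ_w‖^{m_q}` with `m_Θ ≥ 1` and **`e·⌊(m_Θ−1)/e⌋ + 1 − j·(e−1) ≤ m_q`**: THEN the q-pilot region at
`(j, p)` lies in the SLOT hull (the last slot reaches the top of the `p`-level of `t_Θ`, the `j` non-last slots donate `e − 1` orders each —
all inside (Ind2)). Any prime `p`; no tameness hypothesis beyond the ball (tame `e ≤ p − 2`, or boundary `e = p − 1` with `ζ_p ∉ K_x`).
[cite: DupuyHilado2025, §3.9, §4.9, §4.11] [cite: WeilBNT1967, Ch. II §2, Th. 1] [claim: Mochizuki2012, status: disputed] -/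
theorem qRegion_subset_thetaSlotHull_settingDHVolSharp_of_ball_orders (i : Fin (thetaIndex X).lstar) (pp : Nat.Primes) (e : ℕ)
    (ϖ : haveI : Fact (pp : ℕ).Prime := ⟨pp.2⟩; ∀ x : (thetaIndex X).Fibre (.inr pp), (kOf X pp.1 x)ˣ)
    (hfib : haveI : Fact (pp : ℕ).Prime := ⟨pp.2⟩
      ∀ x : (thetaIndex X).Fibre (.inr pp), (placeOf X pp.1 x).asIdeal.ramificationIdx ℤ = e ∧ IsUniformizer (ϖ x) ∧
        logUnits (kOf X pp.1 x) = closedBall (0 : kOf X pp.1 x) ‖(ϖ x : kOf X pp.1 x)‖)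
    (hord : haveI : Fact (pp : ℕ).Prime := ⟨pp.2⟩
      ∀ w : (thetaIndex X).Fibre (.inr pp),
        ‖tq pp w‖ ≤ ‖t pp i w‖ ∨
          ∃ mΘ mq : ℤ, ‖t pp i w‖ = ‖(ϖ w : kOf X pp.1 w)‖ ^ mΘ ∧ ‖tq pp w‖ = ‖(ϖ w : kOf X pp.1 w)‖ ^ mq ∧ 1 ≤ mΘ ∧
            (e : ℤ) * ((mΘ - 1) / e) + 1 - ((i : ℕ) + 1 : ℕ) * ((e : ℤ) - 1) ≤ mq) :
    (settingDHVolSharp X hlog M archPk archSub Ψ act Mmod region n lat sig split qData tq t htq0 htq1).qRegion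
        (labelSucc i) (.inr pp) ⊆
      (settingDHVolSharp X hlog M archPk archSub Ψ act Mmod region n lat sig split qData tq t htq0 htq1).thetaSlotHull
        (labelSucc i) (.inr pp) := by
  haveI hF : Fact (pp : ℕ).Prime := ⟨pp.2⟩
  have hp1 : (1 : ℝ) ≤ (pp : ℕ) := by exact_mod_cast pp.2.one_lt.le
  have hp0 : (0 : ℝ) < (pp : ℕ) := by positivity
  -- the invariants at a place over `p`: `e_K = e`, `‖ϖ_x‖ = p^{-1/e}`, `‖ϖ_x‖^e = p⁻¹`
  have heK : ∀ x : (thetaIndex X).Fibre (.inr pp), absRamificationIdx (pp : ℕ) (kOf X pp.1 x) = e := fun x =>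
    (absRamificationIdx_rescaledCompletion F (pp : ℕ) (placeOf X pp.1 x) (natCast_mem_placeOf X pp.1 x)).trans (hfib x).1
  have he0 : 0 < e := by
    rw [← heK (Classical.arbitrary _)]
    exact absRamificationIdx_pos _ _
  -- donation rate `ρ = p · p^{-1/e}`
  set ρ : ℝ := ((pp : ℕ) : ℝ) * ((pp : ℕ) : ℝ) ^ (-(1 / (e : ℝ))) with hρ
  have hnormϖ : ∀ x : (thetaIndex X).Fibre (.inr pp), ‖(ϖ x : kOf X pp.1 x)‖ = ((pp : ℕ) : ℝ) ^ (-(1 / (e : ℝ))) := by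
    intro x
    rw [norm_eq_rpow_of_isUniformizer (pp : ℕ) (kOf X pp.1 x) (hfib x).2.1, heK x]
  have hρ1 : 1 ≤ ρ := by
    have h : ((pp : ℕ) : ℝ) ^ (-(1 : ℝ)) ≤ ((pp : ℕ) : ℝ) ^ (-(1 / (e : ℝ))) := by
      refine Real.rpow_le_rpow_of_exponent_le hp1 (neg_le_neg ?_)
      rw [div_le_one (by exact_mod_cast he0)]
      exact_mod_cast he0
    calc (1 : ℝ) = ((pp : ℕ) : ℝ) * ((pp : ℕ) : ℝ) ^ (-(1 : ℝ)) := by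
          rw [Real.rpow_neg_one, mul_inv_cancel₀ hp0.ne']
      _ ≤ ρ := mul_le_mul_of_nonneg_left h hp0.le
  refine qRegion_subset_thetaSlotHull_settingDHVolSharp_of_ball_slots X hlog M archPk archSub Ψ act Mmod region n lat sig split qData
    tq t htq0 htq1 i pp ρ hρ1 (fun x => ⟨ϖ x, (hfib x).2.1, (hfib x).2.2, le_of_eq ?_⟩) fun w => ?_
  · -- `ρ = ‖p‖⁻¹ · ‖ϖ_x‖`
    rw [hnormϖ x, Padic.norm_p, inv_inv]
  · rcases hord w with h | ⟨mΘ, mq, hΘ, hq, h1, hle⟩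
    · exact Or.inl h
    · right
      set a : ℝ := ‖(ϖ w : kOf X pp.1 w)‖ with ha
      have ha0 : 0 < a := norm_pos_iff.2 (ϖ w).ne_zero
      have ha1 : a < 1 := (hfib w).2.1.norm_lt_one
      have hae : a ^ e = ((pp : ℕ) : ℝ)⁻¹ := by rw [ha, ← heK w]; exact norm_pow_absRamificationIdx (pp : ℕ) _ (hfib w).2.1
      have hpnorm : ‖((pp : ℕ) : ℚ_[pp])‖ = a ^ (e : ℤ) := by rw [Padic.norm_p, zpow_natCast, hae]
      have hρa : ρ = a ^ (1 - (e : ℤ)) := by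
        rw [zpow_sub₀ ha0.ne', zpow_one, zpow_natCast, hae, div_inv_eq_mul, hρ, ← hnormϖ w, ← ha, mul_comm]
      -- the `p`-level of `t_Θ`: `k = ⌊(m_Θ − 1)/e⌋`
      set k : ℤ := (mΘ - 1) / e with hk
      have hediv : (e : ℤ) * k ≤ mΘ - 1 := Int.mul_ediv_self_le (by exact_mod_cast he0.ne')
      have hemod : mΘ - 1 < (e : ℤ) * k + e := Int.lt_mul_ediv_self_add (by exact_mod_cast he0)
      have hzle : ∀ A B : ℤ, a ^ A ≤ a ^ B ↔ B ≤ A := fun A B => zpow_le_zpow_iff_right_of_lt_one₀ ha0 ha1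
      have hzlt : ∀ A B : ℤ, a ^ A < a ^ B ↔ B < A := fun A B => zpow_lt_zpow_iff_right_of_lt_one₀ ha0 ha1
      refine ⟨ϖ w, k, (hfib w).2.2, ?_, ?_, ?_⟩
      · -- `‖p‖·(‖p‖^k·‖ϖ‖) < ‖t_Θ‖`
        rw [hΘ, hpnorm, ← zpow_mul, ← ha, ← zpow_add_one₀ ha0.ne', ← zpow_add₀ ha0.ne', hzlt]
        linarith
      · -- `‖t_Θ‖ ≤ ‖p‖^k·‖ϖ‖`
        rw [hΘ, hpnorm, ← zpow_mul, ← ha, ← zpow_add_one₀ ha0.ne', hzle]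
        linarith
      · -- `‖t_q‖ ≤ ρ^{i+1}·(‖p‖^k·‖ϖ‖)`
        rw [hq, hpnorm, hρa, ← zpow_mul, ← ha, ← zpow_add_one₀ ha0.ne', ← zpow_natCast, ← zpow_mul,
          ← zpow_add₀ ha0.ne', hzle]
        push_cast at hle ⊢
        linarith

/-! ## 2. The SLOT licence at ball data of one index per bad prime -/

/-- **THE SLOT LICENCE AT `settingDHVolSharp` IN ORDERS (uniformly indexed BALL fibres)** — twin of abc-iut-D1-prv's
`licence_settingDHVolSharp_of_ball_orders` (p456193) with the conclusion `Cor312.Setting.SlotLicence`: Θ-ideles units off `S`; at every prime `p`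
under `S` ONE index `e_p` and uniformizers `ϖ_x` with `log_p(𝒪_x^×) = {‖y‖ ≤ ‖ϖ_x‖}` at every `x | p`; at every bad `w | p` and label `j = i+1`
either `‖t_{q,w}‖ ≤ ‖t_{Θ,j,w}‖` or integer exponents with `m_Θ ≥ 1` and `e_p·((m_Θ − 1) div e_p) + 1 − j·(e_p − 1) ≤ m_q`. Any primes (no `p > 2`).
[cite: DupuyHilado2025, §3.9, §4.9, §4.11] [claim: Mochizuki2012, status: disputed] -/
theorem slotLicence_settingDHVolSharp_of_ball_orders
    (ht1 : ∀ (pp : Nat.Primes) (i : Fin X.lstar) (x : (thetaIndex X).Fibre (.inr pp)),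
      haveI : Fact (pp : ℕ).Prime := ⟨pp.2⟩; placeOf X pp.1 x ∉ X.S → ‖t pp i x‖ = 1)
    (e : Nat.Primes → ℕ)
    (ϖ : ∀ (pp : Nat.Primes) (x : (thetaIndex X).Fibre (.inr pp)), haveI : Fact (pp : ℕ).Prime := ⟨pp.2⟩; (kOf X pp.1 x)ˣ)
    (hfib : ∀ (pp : Nat.Primes) (x : (thetaIndex X).Fibre (.inr pp)),
      haveI : Fact (pp : ℕ).Prime := ⟨pp.2⟩
      (∃ w : (thetaIndex X).Fibre (.inr pp), placeOf X pp.1 w ∈ X.S) →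
        (placeOf X pp.1 x).asIdeal.ramificationIdx ℤ = e pp ∧ IsUniformizer (ϖ pp x) ∧
          logUnits (kOf X pp.1 x) = closedBall (0 : kOf X pp.1 x) ‖(ϖ pp x : kOf X pp.1 x)‖)
    (hord : ∀ (pp : Nat.Primes) (i : Fin (thetaIndex X).lstar) (w : (thetaIndex X).Fibre (.inr pp)),
      haveI : Fact (pp : ℕ).Prime := ⟨pp.2⟩
      placeOf X pp.1 w ∈ X.S →
        ‖tq pp w‖ ≤ ‖t pp i w‖ ∨
          ∃ mΘ mq : ℤ, ‖t pp i w‖ = ‖(ϖ pp w : kOf X pp.1 w)‖ ^ mΘ ∧ ‖tq pp w‖ = ‖(ϖ pp w : kOf X pp.1 w)‖ ^ mq ∧ 1 ≤ mΘ ∧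
            (e pp : ℤ) * ((mΘ - 1) / e pp) + 1 - ((i : ℕ) + 1 : ℕ) * ((e pp : ℤ) - 1) ≤ mq) :
    (settingDHVolSharp X hlog M archPk archSub Ψ act Mmod region n lat sig split qData tq t htq0 htq1).SlotLicence := by
  intro i vQ
  cases vQ with
  | inl u =>
    exact qRegion_subset_thetaSlotHull_settingDHVolSharp_inl X hlog M archPk archSub Ψ act Mmod region n lat sig split qData tq t htq0
      htq1 (labelSucc i) u
  | inr pp =>
    haveI : Fact (pp : ℕ).Prime := ⟨pp.2⟩
    by_cases hS : ∃ w : (thetaIndex X).Fibre (.inr pp), placeOf X pp.1 w ∈ X.S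
    · refine qRegion_subset_thetaSlotHull_settingDHVolSharp_of_ball_orders X hlog M archPk archSub Ψ act Mmod region n lat sig split
        qData tq t htq0 htq1 i pp (e pp) (ϖ pp) (fun x => hfib pp x hS) fun w => ?_
      by_cases hw : placeOf X pp.1 w ∈ X.S
      · exact hord pp i w hw
      · exact Or.inl (by rw [ht1 pp i w hw, htq1 pp w hw])
    · exact qRegion_subset_thetaSlotHull_settingDHVolSharp_of_forall_not_mem X hlog M archPk archSub Ψ act Mmod region n lat sig split
        qData tq t htq0 htq1 i pp ht1 fun w hw => hS ⟨w, hw⟩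

/-- **The same at `settingPrVolSharp`** (abc-iut-c312-7's print-normalised sharp setting — the setting of branch C's K-line certificates;
`slotLicence_settingPrVolSharp_iff_settingDHVolSharp` is `Iff.rfl`). [cite: DupuyHilado2025, §3.9, §4.9] [claim: Mochizuki2012, status: disputed] -/
theorem slotLicence_settingPrVolSharp_of_ball_orders
    (ht1 : ∀ (pp : Nat.Primes) (i : Fin X.lstar) (x : (thetaIndex X).Fibre (.inr pp)),
      haveI : Fact (pp : ℕ).Prime := ⟨pp.2⟩; placeOf X pp.1 x ∉ X.S → ‖t pp i x‖ = 1)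
    (e : Nat.Primes → ℕ)
    (ϖ : ∀ (pp : Nat.Primes) (x : (thetaIndex X).Fibre (.inr pp)), haveI : Fact (pp : ℕ).Prime := ⟨pp.2⟩; (kOf X pp.1 x)ˣ)
    (hfib : ∀ (pp : Nat.Primes) (x : (thetaIndex X).Fibre (.inr pp)),
      haveI : Fact (pp : ℕ).Prime := ⟨pp.2⟩
      (∃ w : (thetaIndex X).Fibre (.inr pp), placeOf X pp.1 w ∈ X.S) →
        (placeOf X pp.1 x).asIdeal.ramificationIdx ℤ = e pp ∧ IsUniformizer (ϖ pp x) ∧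
          logUnits (kOf X pp.1 x) = closedBall (0 : kOf X pp.1 x) ‖(ϖ pp x : kOf X pp.1 x)‖)
    (hord : ∀ (pp : Nat.Primes) (i : Fin (thetaIndex X).lstar) (w : (thetaIndex X).Fibre (.inr pp)),
      haveI : Fact (pp : ℕ).Prime := ⟨pp.2⟩
      placeOf X pp.1 w ∈ X.S →
        ‖tq pp w‖ ≤ ‖t pp i w‖ ∨
          ∃ mΘ mq : ℤ, ‖t pp i w‖ = ‖(ϖ pp w : kOf X pp.1 w)‖ ^ mΘ ∧ ‖tq pp w‖ = ‖(ϖ pp w : kOf X pp.1 w)‖ ^ mq ∧ 1 ≤ mΘ ∧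
            (e pp : ℤ) * ((mΘ - 1) / e pp) + 1 - ((i : ℕ) + 1 : ℕ) * ((e pp : ℤ) - 1) ≤ mq) :
    (settingPrVolSharp X hlog M archPk archSub Ψ act Mmod region n lat sig split qData tq t htq0 htq1).SlotLicence := by
  rw [slotLicence_settingPrVolSharp_iff_settingDHVolSharp]
  exact slotLicence_settingDHVolSharp_of_ball_orders X hlog M archPk archSub Ψ act Mmod region n lat sig split qData tq t htq0 htq1 ht1 e
    ϖ hfib hord

/-! ## 3. REALISING ideles over torsion-free sub-wild bad fibres of one index: the SLOT licence IS the T1½ predicate -/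

/-- **THE SLOT LICENCE AT `settingPrVolSharp` FOR REALISING IDELES WITH INTEGRAL q-DEGREES OVER TORSION-FREE SUB-WILD BAD FIBRES OF ONE INDEX IS
abc-iut-D1-prv's EXACT T1½ PREDICATE** — hence EQUIVALENT to the (U)-licence there. Θ- and q-ideles realising the pilot divisors of `X`
(`ht`/`htq`); integral q-degrees `P_w ≥ 1` at the bad places; every place `x` over a bad prime `p`: `p > 2`, `e(x|p) = e_p ≤ p − 1`, no `ζ ≠ 1`
with `ζ^p = 1` in `K_x`. THEN `SlotLicence ⟺ ∀ bad w | p, ∀ j = i+1: e_p·((j²·P_w − 1) div e_p) + 1 − j·(e_p − 1) ≤ P_w`.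
(⟹) `licence_of_slotLicence` + `licence_settingPrVolSharp_iff_of_realises_boundary` (p456372); (⟸) the slot ball-orders chain with
`m_Θ = j²·P_w`, `m_q = P_w` read off the realising ideles (abc-iut-w5-d009's bookkeeping `norm_thetaIdele_eq_rpow_of_realises` /
`norm_qIdele_eq_rpow_of_realises`) and the ball supplied by `TorsionFree.logUnits_eq_closedBall_of_le_pred`.
[cite: DupuyHilado2025, §3.3, §3.4, §4.9, §4.11] [cite: NeukirchANT1999, Ch. II Prop. (5.5)–(5.7), (6.8)] [claim: Mochizuki2012, status: disputed] -/
theorem slotLicence_settingPrVolSharp_iff_of_realises_boundary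
    (ht0 : ∀ pp i x, t pp i x ≠ 0)
    (ht : ∀ (pp : Nat.Primes) (i : Fin X.lstar) (x : (thetaIndex X).Fibre (.inr pp)),
      haveI : Fact (pp : ℕ).Prime := ⟨pp.2⟩
      Real.log ‖t pp i x‖ = -(X.thetaPilot i (placeOf X pp.1 x)) * logNorm F (placeOf X pp.1 x) /
        localDegree F (placeOf X pp.1 x))
    (htq : ∀ (pp : Nat.Primes) (x : (thetaIndex X).Fibre (.inr pp)),
      haveI : Fact (pp : ℕ).Prime := ⟨pp.2⟩
      Real.log ‖tq pp x‖ = -(X.qPilot (placeOf X pp.1 x)) * logNorm F (placeOf X pp.1 x) /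
        localDegree F (placeOf X pp.1 x))
    (e : Nat.Primes → ℕ)
    (hfib : ∀ (pp : Nat.Primes) (x : (thetaIndex X).Fibre (.inr pp)),
      haveI : Fact (pp : ℕ).Prime := ⟨pp.2⟩
      (∃ w : (thetaIndex X).Fibre (.inr pp), placeOf X pp.1 w ∈ X.S) →
        2 < (pp : ℕ) ∧ e pp ≤ (pp : ℕ) - 1 ∧ (placeOf X pp.1 x).asIdeal.ramificationIdx ℤ = e pp ∧
          ∀ ζ : kOf X pp.1 x, ζ ^ (pp : ℕ) = 1 → ζ = 1)
    (P : ∀ pp : Nat.Primes, (thetaIndex X).Fibre (.inr pp) → ℕ)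
    (hP : ∀ (pp : Nat.Primes) (w : (thetaIndex X).Fibre (.inr pp)),
      haveI : Fact (pp : ℕ).Prime := ⟨pp.2⟩; placeOf X pp.1 w ∈ X.S → X.qPilot (placeOf X pp.1 w) = P pp w)
    (hP1 : ∀ (pp : Nat.Primes) (w : (thetaIndex X).Fibre (.inr pp)),
      haveI : Fact (pp : ℕ).Prime := ⟨pp.2⟩; placeOf X pp.1 w ∈ X.S → 1 ≤ P pp w) :
    (settingPrVolSharp X hlog M archPk archSub Ψ act Mmod region n lat sig split qData tq t htq0 htq1).SlotLicence ↔
      ∀ (pp : Nat.Primes) (i : Fin (thetaIndex X).lstar) (w : (thetaIndex X).Fibre (.inr pp)),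
        haveI : Fact (pp : ℕ).Prime := ⟨pp.2⟩; placeOf X pp.1 w ∈ X.S →
          (e pp : ℤ) * (((((i : ℕ) + 1 : ℕ) : ℤ) ^ 2 * (P pp w : ℤ) - 1) / e pp) + 1 -
            ((i : ℕ) + 1 : ℕ) * ((e pp : ℤ) - 1) ≤ (P pp w : ℤ) := by
  constructor
  · intro h
    exact (licence_settingPrVolSharp_iff_of_realises_boundary X hlog M archPk archSub Ψ act Mmod region n lat sig split qData tq t htq0
      htq1 ht0 ht htq e hfib P hP hP1).1 (Cor312.Setting.licence_of_slotLicence _ h)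
  · intro hwin
    -- uniformizers of the rescaled completions, `‖ϖ_x‖ = p^{−1/e(x|p)}`
    have hex : ∀ (pp : Nat.Primes) (x : (thetaIndex X).Fibre (.inr pp)),
        haveI : Fact (pp : ℕ).Prime := ⟨pp.2⟩
        ∃ ϖ : (kOf X pp.1 x)ˣ, IsUniformizer ϖ ∧ ‖(ϖ : kOf X pp.1 x)‖ =
          ((pp : ℕ) : ℝ) ^ (-(1 / ((placeOf X pp.1 x).asIdeal.ramificationIdx ℤ : ℝ))) := fun pp x => by
      haveI : Fact (pp : ℕ).Prime := ⟨pp.2⟩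
      exact exists_isUniformizer_rescaledCompletion F pp.1 (placeOf X pp.1 x) (natCast_mem_placeOf X pp.1 x)
    choose ϖ hϖ using hex
    -- the norm identities at a bad place `w | p`
    have key : ∀ (pp : Nat.Primes) (w : (thetaIndex X).Fibre (.inr pp)),
        haveI : Fact (pp : ℕ).Prime := ⟨pp.2⟩
        placeOf X pp.1 w ∈ X.S → ∀ m : ℤ, ∀ c : ℝ, (c : ℝ) = (m : ℝ) →
          ((pp : ℕ) : ℝ) ^ (-(c * X.qPilot (placeOf X pp.1 w)) / (ramIdx F (placeOf X pp.1 w) : ℝ)) =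
            ‖(ϖ pp w : kOf X pp.1 w)‖ ^ (m * (P pp w : ℤ)) := by
      intro pp w hw m c hc
      haveI : Fact (pp : ℕ).Prime := ⟨pp.2⟩
      obtain ⟨-, -, hram, -⟩ := hfib pp w ⟨w, hw⟩
      have hp0 : (0 : ℝ) < ((pp : ℕ) : ℝ) := by exact_mod_cast pp.2.pos
      have hramF : (ramIdx F (placeOf X pp.1 w) : ℝ) = (e pp : ℝ) := by
        rw [ramIdx_eq F (placeOf X pp.1 w), hram]
      have hϖn : ‖(ϖ pp w : kOf X pp.1 w)‖ = ((pp : ℕ) : ℝ) ^ (-(1 / (e pp : ℝ))) := by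
        rw [(hϖ pp w).2, hram]
      rw [hϖn, ← Real.rpow_intCast, ← Real.rpow_mul hp0.le, hP pp w hw, hramF, hc]
      congr 1
      push_cast
      ring
    rw [slotLicence_settingPrVolSharp_iff_settingDHVolSharp]
    refine slotLicence_settingDHVolSharp_of_ball_orders X hlog M archPk archSub Ψ act Mmod region n lat sig split qData tq t htq0 htq1
      (fun pp i x hx => norm_eq_one_of_realises X t ht0 ht pp i x hx) e ϖ (fun pp x hS => ?_) (fun pp i w hw => ?_)
    · -- the ball at every place over a bad prime (abc-iut-w6-d060)
      haveI : Fact (pp : ℕ).Prime := ⟨pp.2⟩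
      obtain ⟨hp2, hep, hram, hμ⟩ := hfib pp x hS
      have heK : absRamificationIdx (pp : ℕ) (kOf X pp.1 x) ≤ (pp : ℕ) - 1 := by
        rw [absRamificationIdx_rescaledCompletion F (pp : ℕ) (placeOf X pp.1 x) (natCast_mem_placeOf X pp.1 x), hram]
        exact hep
      exact ⟨hram, (hϖ pp x).1, TorsionFree.logUnits_eq_closedBall_of_le_pred (pp : ℕ) (hϖ pp x).1 hμ (by omega) heK⟩
    · haveI : Fact (pp : ℕ).Prime := ⟨pp.2⟩
      refine Or.inr ⟨(((i : ℕ) + 1 : ℕ) : ℤ) ^ 2 * (P pp w : ℤ), (P pp w : ℤ), ?_, ?_, ?_, hwin pp i w hw⟩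
      · -- `‖t_{Θ,i,w}‖ = ‖ϖ_w‖^{(i+1)²·P_w}`
        rw [norm_thetaIdele_eq_rpow_of_realises X tq t htq0 ht0 ht htq pp i w]
        exact key pp w hw _ _ (by push_cast; ring)
      · -- `‖t_{q,w}‖ = ‖ϖ_w‖^{P_w}`
        rw [norm_qIdele_eq_rpow_of_realises X tq htq0 htq pp w]
        have h := key pp w hw 1 1 (by norm_num)
        rw [one_mul, one_mul] at h
        exact h
      · -- `1 ≤ (i+1)²·P_w`
        have h1 : (1 : ℤ) ≤ (P pp w : ℤ) := by exact_mod_cast hP1 pp w hw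
        have h2 : (1 : ℤ) ≤ (((i : ℕ) + 1 : ℕ) : ℤ) ^ 2 := one_le_pow₀ (by exact_mod_cast Nat.succ_le_succ (Nat.zero_le _))
        nlinarith

end Summit.ABC.IUTFork.Thm311.Real

end
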